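import Summits.AnomalousDissipation.AnomalousDissipation.Theorems.SoloInformedMomentumBalance
import Summits.AnomalousDissipation.AnomalousDissipation.Theorems.SoloInformedWitnessConstraints
import HarnessLib

/-!
# The exact injection law for a Stokes eigen-force (solo-informed)

For a steady smooth divergence-free mean-zero force which is a Stokes eigenfunction, `-Δf = λ f`
(`λ > 0`; every single-shell force, e.g. Kolmogorov or ABC forcing), the Reynolds-stress balance
law of `SoloInformedMomentumBalance` becomes an EXACT LAW FOR THE INJECTED POWER of any global
Leray–Hopf solution `u` of viscosity `ν > 0` on `T^d`:

  `ν λ ⟨(f, u)⟩_T = ‖f‖₂² + ⟨(u ⊗ u : ∇f)⟩_T − T⁻¹[(u(T), f) − (u₀, f)]`   for every `T > 0`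

(`lerayHopf_eigenforce_timeMean_identity`), hence `ν λ ⟨(f,u)⟩_T − ‖f‖₂² − ⟨(u ⊗ u : ∇f)⟩_T → 0`
(`lerayHopf_eigenforce_balance_tendsto_zero`) and, for the `limsup` means of the summit,

  `meanPower f u = (ν λ)⁻¹ · ( ‖f‖₂² + ⟨(u ⊗ u : ∇f)⟩ )`,  `⟨·⟩ = longTimeAvgSup`

(`lerayHopf_eigenforce_meanPower_eq`).  The injected power — which bounds the dissipation
`⟨ν‖∇u‖₂²⟩ ≤ ⟨(f,u)⟩` and equals it for classical solutions — is EXACTLY the STRESS DEFECT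
`‖f‖₂² + ⟨(u ⊗ u : ∇f)⟩` divided by `νλ`.  Consequently (`zerothLaw_eigenWitness_stressDefect`)
a zeroth-law witness driven by an eigen-force must keep, for every `j`,

  `ν_j λ ε ≤ ‖f‖₂² + ⟨(u_j ⊗ u_j : ∇f)⟩ ≤ ν_j λ ‖f‖₂ √E`:

the mean Reynolds stress against `∇f` must cancel the injected momentum `‖f‖₂²` up to a defect
which is `O(ν_j)` but NOT `o(ν_j)` — an `O(ν)`-fine balance of an `O(1)` quadratic statistic,
uniformly along the family.  This is the sharpest kernel form of "what a proof must control" for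
single-shell forces.

References: Doering–Foias, J. Fluid Mech. 467 (2002) §2–§3 [DoeringFoias2002]; Cheskidov–Doering–
Petrov, J. Math. Phys. 48 (2007) §III [CheskidovDoeringPetrov2006].
-/

noncomputable section

open MeasureTheory Filter Topology Set
open scoped ENNReal NNReal InnerProductSpace RealInnerProductSpace

namespace Summit.AnomalousDissipation.AnomalousDissipation.Theorems

open Literature.Analysis.FunctionSpaces Literature.Analysis.FluidPDE

variable {d : Type*} [Fintype d] [DecidableEq d]

omit [Fintype d] [DecidableEq d] in
/-- `limsup (x + y) = limsup x` along `atTop` when `y → 0` and `x` is eventually bounded.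
[folklore] -/
theorem limsup_add_eq_of_tendsto_zero {x y : ℝ → ℝ} {K : ℝ} (hK : ∀ᶠ T in atTop, |x T| ≤ K)
    (hy : Tendsto y atTop (𝓝 0)) :
    limsup (fun T => x T + y T) atTop = limsup x atTop := by
  have hxb : IsBoundedUnder (· ≤ ·) atTop x :=
    isBoundedUnder_of_eventually_le (a := K) (hK.mono fun T hT => (le_abs_self _).trans hT)
  have hxc : IsCoboundedUnder (· ≤ ·) atTop x :=
    isCoboundedUnder_le_of_eventually_le atTop (x := -K)
      (hK.mono fun T hT => (neg_le_neg hT).trans (neg_abs_le _))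
  refine le_antisymm (le_of_forall_pos_le_add fun δ hδ => ?_)
    (le_of_forall_pos_le_add fun δ hδ => ?_)
  · have hyδ : ∀ᶠ T in atTop, y T < δ := (tendsto_order.1 hy).2 δ hδ
    calc limsup (fun T => x T + y T) atTop ≤ limsup (fun T => x T + δ) atTop := by
          refine limsup_le_limsup (by filter_upwards [hyδ] with T hT; linarith) ?_ ?_
          · exact isCoboundedUnder_le_of_eventually_le atTop (x := -K - δ)
              (by filter_upwards [hK, (tendsto_order.1 hy).1 (-δ) (by linarith)] with T hT hT'
                  linarith [neg_abs_le (x T)])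
          · exact isBoundedUnder_of_eventually_le (a := K + δ)
              (hK.mono fun T hT => by linarith [le_abs_self (x T)])
      _ = limsup x atTop + δ := limsup_add_const atTop x δ hxb hxc
  · have hyδ : ∀ᶠ T in atTop, -δ < y T := (tendsto_order.1 hy).1 (-δ) (by linarith)
    calc limsup x atTop ≤ limsup (fun T => (x T + y T) + δ) atTop := by
          refine limsup_le_limsup (by filter_upwards [hyδ] with T hT; linarith) hxc ?_
          exact isBoundedUnder_of_eventually_le (a := K + δ + δ)
            (by filter_upwards [hK, (tendsto_order.1 hy).2 δ hδ] with T hT hT'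
                linarith [le_abs_self (x T)])
      _ = limsup (fun T => x T + y T) atTop + δ := by
          refine limsup_add_const atTop (fun T => x T + y T) δ ?_ ?_
          · exact isBoundedUnder_of_eventually_le (a := K + δ)
              (by filter_upwards [hK, (tendsto_order.1 hy).2 δ hδ] with T hT hT'
                  linarith [le_abs_self (x T)])
          · exact isCoboundedUnder_le_of_eventually_le atTop (x := -K - δ)
              (by filter_upwards [hK, hyδ] with T hT hT'
                  linarith [neg_abs_le (x T)])

section OneSolution

variable {ν μ : ℝ} {f u₀ : UnitAddTorus d → EuclideanSpace ℝ d}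
  {u : ℝ → UnitAddTorus d → EuclideanSpace ℝ d}

omit [DecidableEq d] in
/-- For a Stokes eigen-force `Δf = -μ f` the viscous pairing is `-μ` times the injection:
`∫⟪v, Δf⟫ = -μ ∫⟪f, v⟫`. [folklore] -/
theorem integral_inner_laplacian_of_eigen (hlap : ∀ x, Torus.laplacian f x = -(μ • f x))
    (v : UnitAddTorus d → EuclideanSpace ℝ d) :
    ∫ x, ⟪v x, Torus.laplacian f x⟫ = -μ * ∫ x, ⟪f x, v x⟫ := by
  rw [← integral_const_mul]
  refine integral_congr_ae (ae_of_all _ fun x => ?_)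
  show ⟪v x, Torus.laplacian f x⟫ = -μ * ⟪f x, v x⟫
  rw [hlap x, inner_neg_right, inner_smul_right, real_inner_comm]
  ring

/-- **Finite-time injection law for an eigen-force**: for `T > 0`,
`ν μ T⁻¹∫₀ᵀ (f, u) = ‖f‖₂² + T⁻¹∫₀ᵀ (u ⊗ u : ∇f) − T⁻¹[(u(T), f) − (u₀, f)]`.
[cite: DoeringFoias2002, §2] -/
theorem lerayHopf_eigenforce_timeMean_identity (hf : Torus.IsSmooth f)
    (hdiv : Torus.IsDivFree f) (hlap : ∀ x, Torus.laplacian f x = -(μ • f x))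
    (hu : Torus.IsGlobalLerayHopf ν (fun _ => f) u₀ u) {T : ℝ} (hT : 0 < T) :
    ν * μ * timeMean (fun s => ∫ x, ⟪f x, u s x⟫) T =
      (∫ x, ‖f x‖ ^ 2) + timeMean (fun s => ∫ x, ⟪u s x, Torus.convect (u s) f x⟫) T
        - T⁻¹ * ((∫ x, ⟪u T x, f x⟫) - ∫ x, ⟪u₀ x, f x⟫) := by
  have hsplit := lerayHopf_timeMean_flux_split hf hu hT
  have hflux := lerayHopf_timeMean_flux_eq hf hdiv hu hT
  have hL : timeMean (fun s => ∫ x, ⟪u s x, Torus.laplacian f x⟫) T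
      = -μ * timeMean (fun s => ∫ x, ⟪f x, u s x⟫) T := by
    have h1 : (fun s => ∫ x, ⟪u s x, Torus.laplacian f x⟫) = fun s => -μ * ∫ x, ⟪f x, u s x⟫ :=
      funext fun s => integral_inner_laplacian_of_eigen hlap (u s)
    rw [h1]
    unfold timeMean
    rw [intervalIntegral.integral_const_mul]
    ring
  rw [hL] at hsplit
  linear_combination hsplit - hflux

/-- **The injection law as a limit**: `ν μ ⟨(f,u)⟩_T − ‖f‖₂² − ⟨(u ⊗ u : ∇f)⟩_T → 0` as `T → ∞`
(`ν > 0`, mean-zero eigen-force). [cite: DoeringFoias2002, §2] -/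
theorem lerayHopf_eigenforce_balance_tendsto_zero (hν : 0 < ν) (hf : Torus.IsSmooth f)
    (hdiv : Torus.IsDivFree f) (hmean : Torus.HasZeroMean f)
    (hlap : ∀ x, Torus.laplacian f x = -(μ • f x))
    (hu : Torus.IsGlobalLerayHopf ν (fun _ => f) u₀ u) :
    Tendsto (fun T => ν * μ * timeMean (fun s => ∫ x, ⟪f x, u s x⟫) T
      - ((∫ x, ‖f x‖ ^ 2) + timeMean (fun s => ∫ x, ⟪u s x, Torus.convect (u s) f x⟫) T))
      atTop (𝓝 0) := by
  have h := (lerayHopf_timeMean_flux_tendsto_zero hν hf hdiv hmean hu).neg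
  rw [neg_zero] at h
  refine Tendsto.congr' ?_ h
  filter_upwards [eventually_gt_atTop 0] with T hT
  have h1 : (fun s => ∫ x, ⟪u s x, Torus.laplacian f x⟫) = fun s => -μ * ∫ x, ⟪f x, u s x⟫ :=
    funext fun s => integral_inner_laplacian_of_eigen hlap (u s)
  rw [lerayHopf_timeMean_flux_split hf hu hT, h1]
  unfold timeMean
  rw [intervalIntegral.integral_const_mul]
  ring

/-- **Exact injection law, `limsup` means**: for `ν, μ > 0` and a smooth divergence-free mean-zero
eigen-force `Δf = -μ f`, every global Leray–Hopf solution has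
`⟨(f,u)⟩ = (νμ)⁻¹ (‖f‖₂² + ⟨(u ⊗ u : ∇f)⟩)` (`⟨·⟩ = longTimeAvgSup`): the injected power is the
stress defect divided by `νμ`. [cite: DoeringFoias2002, §3] -/
theorem lerayHopf_eigenforce_meanPower_eq (hν : 0 < ν) (hμ : 0 < μ) (hf : Torus.IsSmooth f)
    (hdiv : Torus.IsDivFree f) (hmean : Torus.HasZeroMean f)
    (hlap : ∀ x, Torus.laplacian f x = -(μ • f x))
    (hu : Torus.IsGlobalLerayHopf ν (fun _ => f) u₀ u) :
    meanPower f u = (ν * μ)⁻¹ * ((∫ x, ‖f x‖ ^ 2)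
      + longTimeAvgSup (fun s => ∫ x, ⟪u s x, Torus.convect (u s) f x⟫)) := by
  obtain ⟨G, hG0, hG⟩ := Torus.exists_sum_norm_partialDeriv_le hf
  have hνμ : 0 < ν * μ := mul_pos hν hμ
  -- the stress means are eventually bounded
  obtain ⟨K, hK⟩ : ∃ K, ∀ᶠ T in atTop, timeMean (fun s => ∫ x, ‖u s x‖ ^ 2) T ≤ K :=
    (hu.isBoundedUnder_timeMean_energy hν (hf.memLp 2) hmean).eventually_le
  have hS : ∀ᶠ T in atTop,
      |(ν * μ)⁻¹ * ((∫ x, ‖f x‖ ^ 2)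
        + timeMean (fun s => ∫ x, ⟪u s x, Torus.convect (u s) f x⟫) T)|
        ≤ (ν * μ)⁻¹ * ((∫ x, ‖f x‖ ^ 2) + G * K) := by
    filter_upwards [hK, eventually_gt_atTop 0] with T hTK hT
    have h1 := lerayHopf_abs_timeMean_stress_le hf hu hG hT
    rw [abs_mul, abs_of_pos (inv_pos.2 hνμ)]
    refine mul_le_mul_of_nonneg_left ((abs_add_le _ _).trans ?_) (inv_nonneg.2 hνμ.le)
    rw [abs_of_nonneg (integral_nonneg fun x => sq_nonneg _)]
    exact add_le_add le_rfl (h1.trans (mul_le_mul_of_nonneg_left hTK hG0))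
  -- P_T = (νμ)⁻¹ (c + S_T) + r_T with r_T → 0
  have hr : Tendsto (fun T => timeMean (fun s => ∫ x, ⟪f x, u s x⟫) T
      - (ν * μ)⁻¹ * ((∫ x, ‖f x‖ ^ 2)
        + timeMean (fun s => ∫ x, ⟪u s x, Torus.convect (u s) f x⟫) T)) atTop (𝓝 0) := by
    have h := (lerayHopf_eigenforce_balance_tendsto_zero hν hf hdiv hmean hlap hu).const_mul
      (ν * μ)⁻¹
    rw [mul_zero] at h
    refine Tendsto.congr' ?_ h
    filter_upwards with T
    rw [mul_sub, inv_mul_cancel_left₀ hνμ.ne']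
  have key : limsup (fun T => (ν * μ)⁻¹ * ((∫ x, ‖f x‖ ^ 2)
        + timeMean (fun s => ∫ x, ⟪u s x, Torus.convect (u s) f x⟫) T)
      + (timeMean (fun s => ∫ x, ⟪f x, u s x⟫) T
        - (ν * μ)⁻¹ * ((∫ x, ‖f x‖ ^ 2)
          + timeMean (fun s => ∫ x, ⟪u s x, Torus.convect (u s) f x⟫) T))) atTop
      = limsup (fun T => (ν * μ)⁻¹ * ((∫ x, ‖f x‖ ^ 2)
        + timeMean (fun s => ∫ x, ⟪u s x, Torus.convect (u s) f x⟫) T)) atTop :=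
    limsup_add_eq_of_tendsto_zero hS hr
  have hsum : (fun T => (ν * μ)⁻¹ * ((∫ x, ‖f x‖ ^ 2)
        + timeMean (fun s => ∫ x, ⟪u s x, Torus.convect (u s) f x⟫) T)
      + (timeMean (fun s => ∫ x, ⟪f x, u s x⟫) T
        - (ν * μ)⁻¹ * ((∫ x, ‖f x‖ ^ 2)
          + timeMean (fun s => ∫ x, ⟪u s x, Torus.convect (u s) f x⟫) T)))
      = timeMean (fun s => ∫ x, ⟪f x, u s x⟫) := funext fun T => by ring
  rw [hsum] at key
  -- `limsup` passes through the increasing affine map `y ↦ (νμ)⁻¹ (c + y)`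
  have hmono : Monotone fun y : ℝ => (ν * μ)⁻¹ * ((∫ x, ‖f x‖ ^ 2) + y) := fun a b hab =>
    mul_le_mul_of_nonneg_left (add_le_add le_rfl hab) (inv_nonneg.2 hνμ.le)
  have hcont : Continuous fun y : ℝ => (ν * μ)⁻¹ * ((∫ x, ‖f x‖ ^ 2) + y) :=
    continuous_const.mul (continuous_const.add continuous_id)
  have hSb : IsBoundedUnder (· ≤ ·) atTop
      (timeMean fun s => ∫ x, ⟪u s x, Torus.convect (u s) f x⟫) :=
    isBoundedUnder_of_eventually_le (a := G * K) (by
      filter_upwards [hK, eventually_gt_atTop 0] with T hTK hT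
      exact (le_abs_self _).trans ((lerayHopf_abs_timeMean_stress_le hf hu hG hT).trans
        (mul_le_mul_of_nonneg_left hTK hG0)))
  have hSc : IsCoboundedUnder (· ≤ ·) atTop
      (timeMean fun s => ∫ x, ⟪u s x, Torus.convect (u s) f x⟫) :=
    isCoboundedUnder_le_of_eventually_le atTop (x := -(G * K)) (by
      filter_upwards [hK, eventually_gt_atTop 0] with T hTK hT
      exact (neg_le_neg ((lerayHopf_abs_timeMean_stress_le hf hu hG hT).trans
        (mul_le_mul_of_nonneg_left hTK hG0))).trans (neg_abs_le _))
  have hmap := hmono.map_limsup_of_continuousAt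
    (timeMean fun s => ∫ x, ⟪u s x, Torus.convect (u s) f x⟫) hcont.continuousAt hSb hSc
  unfold meanPower longTimeAvgSup
  rw [key, hmap]
  rfl

end OneSolution

/-! ### The stress defect of an eigen-forced zeroth-law witness -/

/-- The physical flat unit torus `T³ = (ℝ/ℤ)³` (local notation). -/
local notation "𝕋³" => UnitAddTorus (Fin 3)
/-- Velocity values on `T³` (local notation). -/
local notation "E³" => EuclideanSpace ℝ (Fin 3)

/-- **Stress-defect law for an eigen-forced witness.**  If the data of a zeroth-law witness are
driven by a smooth divergence-free mean-zero Stokes eigen-force `Δf = -μ f`, `μ > 0`, then for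
every `j` the mean Reynolds stress of `u_j` against `∇f` misses full cancellation of the injected
momentum by a defect pinned between `ν_j μ ε` and `ν_j μ ‖f‖₂ √E`:
`ν_j μ ε ≤ ‖f‖₂² + ⟨(u_j ⊗ u_j : ∇f)⟩ ≤ ν_j μ ‖f‖₂ √E`. [cite: DoeringFoias2002, §3] -/
theorem zerothLaw_eigenWitness_stressDefect {f : 𝕋³ → E³} (hf : Torus.IsSmooth f)
    (hdiv : Torus.IsDivFree f) (hmean : Torus.HasZeroMean f) {μ : ℝ} (hμ : 0 < μ)
    (hlap : ∀ x, Torus.laplacian f x = -(μ • f x)) {ν : ℕ → ℝ} {u₀ : ℕ → 𝕋³ → E³}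
    {u : ℕ → ℝ → 𝕋³ → E³} (hν : ∀ j, 0 < ν j)
    (hLH : ∀ j, Torus.IsGlobalLerayHopf (ν j) (fun _ => f) (u₀ j) (u j)) {E ε : ℝ}
    (hE : ∀ j, meanEnergy (u j) ≤ E) (hεle : ∀ j, ε ≤ meanDissipation (ν j) (u j)) (j : ℕ) :
    ν j * μ * ε ≤ (∫ x, ‖f x‖ ^ 2)
        + longTimeAvgSup (fun s => ∫ x, ⟪u j s x, Torus.convect (u j s) f x⟫) ∧
      (∫ x, ‖f x‖ ^ 2) + longTimeAvgSup (fun s => ∫ x, ⟪u j s x, Torus.convect (u j s) f x⟫)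
        ≤ ν j * μ * (Real.sqrt (∫ x, ‖f x‖ ^ 2) * Real.sqrt E) := by
  have hνμ : 0 < ν j * μ := mul_pos (hν j) hμ
  have hP := lerayHopf_eigenforce_meanPower_eq (hν j) hμ hf hdiv hmean hlap (hLH j)
  have hlow : ε ≤ meanPower f (u j) := zerothLaw_witness_injection_floor hf hmean hν hLH hεle j
  have hup : meanPower f (u j) ≤ Real.sqrt (∫ x, ‖f x‖ ^ 2) * Real.sqrt E := by
    have h := Torus.IsGlobalLerayHopf.meanPower_le (hν j) hf hmean (hLH j)
    rw [rmsVelocity_eq_sqrt_meanEnergy] at h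
    exact h.trans (mul_le_mul_of_nonneg_left (Real.sqrt_le_sqrt (hE j)) (Real.sqrt_nonneg _))
  rw [hP] at hlow hup
  constructor
  · have h := mul_le_mul_of_nonneg_left hlow hνμ.le
    rwa [mul_inv_cancel_left₀ hνμ.ne'] at h
  · have h := mul_le_mul_of_nonneg_left hup hνμ.le
    rwa [mul_inv_cancel_left₀ hνμ.ne'] at h

end Summit.AnomalousDissipation.AnomalousDissipation.Theorems

end
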